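import Summits.Ventures.YMGap.RobustBall.StateStabilityRows
import HarnessLib

/-!
# Venture YMGap, track ROBUST-BALL — C-LIP IN THE COUPLING FOR BALL MEMBERS (and for Wilson against an ARBITRARY second
# coupling): Grüss's inequality bounds the one-link coupling defect WITHOUT a radius condition on the second coupling

HONEST FRAMING: venture file of the cell `pub-ymgap` (QuantumFields programme), track Y2 ROBUST-BALL, seat ds-1; companion of
`Thresholds/StateLipschitz.lean` / `RobustBall/StateStability.lean`.  Strong-coupling LATTICE statements for `SU(N)` lattice Yang–Mills on
`ℤ^d` and rb-p1's perturbed members `N β S_W + W`; Lipschitz statements (not `C¹`); nothing about the continuum or the Clay problem.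

THE POINT.  In `StateLipschitz` the coupling defect is bounded by the one-link MODULUS, which needs both couplings inside the radius
`2(d−1)|β'| ≤ R`.  Grüss's inequality for tilts (`StateStability.abs_tilt_sub_tilt_le_of_osc_sub`) bounds the same defect by the OSCILLATION of
the difference of the tilt functions, `N(β − β') Re tr(g S_η)` (`|Re tr(g S)| ≤ √N ‖S‖_F ≤ 2(d−1) N`), i.e. by `2(d−1) N^{5/2} |β − β'| · L` —
for EVERY real `β'` and for every member `W` (the perturbation `V` is common to both tilts and cancels).  Hence:
* `abs_integral_sub_integral_member_coupling_le` — a member `(W, supp)` that is a Dobrushin contraction at `β` (any door, row sums `≤ c₁ < 1`):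
  for EVERY `β'`, all DLR states `μ` of the member at `β` and `ν` of the SAME member at `β'`:
  `|∫ f dμ − ∫ f dν| ≤ 2(d−1) N^{5/2} |β − β'| / (1 − c₁) · Σ δ(f)` — C-LIP in the coupling ON THE BALL; with `StateStability` (action
  direction) the state is jointly Lipschitz in `(β, W)`.
* `abs_integral_sub_integral_le_any_coupling` — the Wilson case `W = 0`: for `β` in the one-link window and ANY real `β'`,
  `|μ_β f − ν_{β'} f| ≤ 2(d−1) N^{5/2} |β − β'| / (1 − c) · Σ δ(f)` (no radius condition on `β'`; constant `N²`-worse than the modulus route).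
* `su2_abs_integral_sub_integral_member_coupling_le` — `SU(2)`, `d = 4`, HYPOTHESIS-FREE on rb-p1's lineage-(B) door: member of
  `MemBallZd (2ε) ε R'` at `0 ≤ β_W ≤ 1/6` with `ρ = 3√3 β_W e^{2ε} + e^{ε}√(2/3) ε < 1`, any `β'_W`: `≤ 6√2 |β_W − β'_W| / (1 − ρ) · Σ δ(f)`.

References (mechanism): H. Föllmer, LNM 1362 (1988), Ch. I (2.8); G. Grüss, Math. Z. 39 (1935) 215–226.
-/

noncomputable section

open MeasureTheory Function Finset ProbabilityTheory Real
open scoped NNReal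
open Literature.Probability.LatticeModels
open Literature.Probability.LatticeModels.DobrushinMetric
open Literature.MathematicalPhysics.QuantumLattice
open Literature.MathematicalPhysics.QuantumFieldTheory hiding ZdEdge
open Literature.MathematicalPhysics.QuantumFieldTheory.Balaban1983to89.StrongCouplingDobrushinWindow
open Summit.QuantumFields.BalabanUV.InfraRed.StrongCouplingPoincareDoorSUN (oneLinkPoincareSUN_two_sharp)
open Summit.Ventures.YMGap.OneLinkTiltStability
open Summit.Ventures.YMGap.StateLipschitz
open Summit.Ventures.YMGap.RobustBall.StateStability

namespace Summit.Ventures.YMGap.RobustBall.StateLipschitzMember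

variable {d N : ℕ}

/-- **One-link coupling defect by Grüss, no radius condition.**  For a link potential `W` with measurable bounded terms listed by
`supp`, and ANY two 't Hooft couplings `β, β'`: the one-link laws at `e` (same exterior `η`) of `N β S_W + W` and `N β' S_W + W` are within
Kantorovich–Rubinstein distance `2(d−1) N^{5/2} |β − β'|` (Frobenius weight). [folklore] -/
theorem oneLink_member_coupling_defect (hd : 1 ≤ d) (β β' : ℝ)
    {W : Potential (ZdEdge d) (Matrix.specialUnitaryGroup (Fin N) ℂ)} (hWm : ∀ X, Measurable (W X))
    (hWb : ∀ X, ∃ C, ∀ U, |W X U| ≤ C) (supp : Finset (ZdEdge d) → Finset (Finset (ZdEdge d))) (e : ZdEdge d)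
    (η : LGConfig d (Matrix.specialUnitaryGroup (Fin N) ℂ))
    (φ : Matrix.specialUnitaryGroup (Fin N) ℂ → ℝ) (L : ℝ) (hφm : Measurable φ) (hφb : ∃ M, ∀ s, |φ s| ≤ M)
    (hL : 0 ≤ L) (hφL : ∀ a b, |φ a - φ b| ≤ L * suFrobDist a b) :
    |∫ s, φ s ∂(siteLaw (perturbedYM (fundamentalRep (Fin N)) (N * β) W supp) e η) -
        ∫ s, φ s ∂(siteLaw (perturbedYM (fundamentalRep (Fin N)) (N * β') W supp) e η)| ≤
      2 * ((d : ℝ) - 1) * (N : ℝ) ^ 2 * Real.sqrt N * |β - β'| * L := by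
  classical
  rw [siteLaw_perturbedYM_thooft β hWm supp e η, siteLaw_perturbedYM_thooft β' hWm supp e η]
  -- write both tilts as `h_{β} − V_i` with the common base field `B = stapleField β e η`
  set V : Matrix.specialUnitaryGroup (Fin N) ℂ → ℝ := fun g => hamiltonianIn W supp {e} (Function.update η e g) with hV
  set w : Matrix.specialUnitaryGroup (Fin N) ℂ → ℝ := fun g =>
    (N : ℝ) * ((g : Matrix (Fin N) (Fin N) ℂ) * stapleField β e η).trace.re -
      (N : ℝ) * ((g : Matrix (Fin N) (Fin N) ℂ) * stapleField β' e η).trace.re with hw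
  have hVm : Measurable V := (measurable_hamiltonianIn hWm supp {e}).comp (measurable_update η)
  have hVb : ∃ C, ∀ g, |V g| ≤ C := by
    choose Cb hCb using hWb
    refine ⟨∑ X ∈ (supp {e}).filter (fun X => (X ∩ {e}).Nonempty), Cb X, fun g => ?_⟩
    simp only [hV]
    unfold hamiltonianIn
    exact (Finset.abs_sum_le_sum_abs _ _).trans (Finset.sum_le_sum fun X _ => hCb X _)
  obtain ⟨hm₁, hb₁⟩ := su_linear_potential_measurable_bounded (N := N) (stapleField β e η)
  obtain ⟨hm₂, hb₂⟩ := su_linear_potential_measurable_bounded (N := N) (stapleField β' e η)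
  have hwm : Measurable w := hm₁.sub hm₂
  -- the second tilt as `h_β − (V + w)`
  have hrew : (fun g : Matrix.specialUnitaryGroup (Fin N) ℂ =>
      (N : ℝ) * ((g : Matrix (Fin N) (Fin N) ℂ) * stapleField β' e η).trace.re -
        hamiltonianIn W supp {e} (Function.update η e g)) =
      fun g : Matrix.specialUnitaryGroup (Fin N) ℂ =>
        (N : ℝ) * ((g : Matrix (Fin N) (Fin N) ℂ) * stapleField β e η).trace.re -
          (fun g' : Matrix.specialUnitaryGroup (Fin N) ℂ => V g' + w g') g := by
    funext g; simp only [hV, hw]; ring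
  rw [hrew]
  have hV₂m : Measurable fun g => V g + w g := hVm.add hwm
  have hV₂b : ∃ C, ∀ g, |V g + w g| ≤ C := by
    obtain ⟨C, hC⟩ := hVb
    refine ⟨C + ((N : ℝ) * (Real.sqrt N * frobNorm (stapleField β e η)) +
      (N : ℝ) * (Real.sqrt N * frobNorm (stapleField β' e η))), fun g => ?_⟩
    have := abs_sub (((N : ℝ) * ((g : Matrix (Fin N) (Fin N) ℂ) * stapleField β e η).trace.re))
      ((N : ℝ) * ((g : Matrix (Fin N) (Fin N) ℂ) * stapleField β' e η).trace.re)
    calc |V g + w g| ≤ |V g| + |w g| := abs_add_le _ _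
      _ ≤ C + _ := add_le_add (hC g) (this.trans (add_le_add (hb₁ g) (hb₂ g)))
  -- oscillation of the difference `w = N Re tr(g (B − B'))`, `B − B' = (β − β') S_η`: `|w| ≤ 2(d−1) N² |β − β'|`
  have hNN : Real.sqrt N * Real.sqrt N = N := Real.mul_self_sqrt (Nat.cast_nonneg N)
  have hd1 : (0 : ℝ) ≤ (d : ℝ) - 1 := by
    have : (1 : ℝ) ≤ d := by exact_mod_cast hd
    linarith
  have hbound : ∀ g : Matrix.specialUnitaryGroup (Fin N) ℂ, |w g| ≤ 2 * ((d : ℝ) - 1) * (N : ℝ) ^ 2 * |β - β'| := by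
    intro g
    have hdiff : stapleField β e η - stapleField β' e η = ((β - β' : ℝ) : ℂ) • stapleSum e η := by
      rw [stapleField, stapleField, ← sub_smul, ← Complex.ofReal_sub]
    have h1 : w g = (N : ℝ) * ((g : Matrix (Fin N) (Fin N) ℂ) * (stapleField β e η - stapleField β' e η)).trace.re := by
      simp only [hw, Matrix.mul_sub, Matrix.trace_sub, Complex.sub_re]; ring
    have hcard : ((plaquettesTouching {e}).card : ℝ) ≤ 2 * ((d : ℝ) - 1) := by
      calc ((plaquettesTouching {e}).card : ℝ) ≤ ((2 * (d - 1) : ℕ) : ℝ) := by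
            exact_mod_cast card_plaquettesTouching_singleton_le e
        _ = 2 * ((d : ℝ) - 1) := by push_cast [Nat.cast_sub hd]; ring
    have hfrob : frobNorm (stapleField β e η - stapleField β' e η) ≤ |β - β'| * (2 * ((d : ℝ) - 1) * Real.sqrt N) := by
      rw [hdiff, frobNorm_smul, Complex.norm_real, Real.norm_eq_abs]
      exact mul_le_mul_of_nonneg_left ((frobNorm_stapleSum_le e η).trans
        (mul_le_mul_of_nonneg_right hcard (Real.sqrt_nonneg _))) (abs_nonneg _)
    rw [h1, abs_mul, abs_of_nonneg (Nat.cast_nonneg N)]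
    calc (N : ℝ) * |((g : Matrix (Fin N) (Fin N) ℂ) * (stapleField β e η - stapleField β' e η)).trace.re|
        ≤ (N : ℝ) * (Real.sqrt N * (|β - β'| * (2 * ((d : ℝ) - 1) * Real.sqrt N))) :=
          mul_le_mul_of_nonneg_left ((abs_re_trace_su_mul_le g _).trans
            (mul_le_mul_of_nonneg_left hfrob (Real.sqrt_nonneg _))) (Nat.cast_nonneg N)
      _ = 2 * ((d : ℝ) - 1) * ((N : ℝ) * (Real.sqrt N * Real.sqrt N)) * |β - β'| := by ring
      _ = 2 * ((d : ℝ) - 1) * (N : ℝ) ^ 2 * |β - β'| := by rw [hNN]; ring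
  have hosc : ∀ a b : Matrix.specialUnitaryGroup (Fin N) ℂ,
      |(V a - (V a + w a)) - (V b - (V b + w b))| ≤ 4 * ((d : ℝ) - 1) * (N : ℝ) ^ 2 * |β - β'| := by
    intro a b
    calc |(V a - (V a + w a)) - (V b - (V b + w b))| = |w b - w a| := by ring_nf
      _ ≤ |w b| + |w a| := abs_sub _ _
      _ ≤ _ := by linarith [hbound a, hbound b]
  have key := abs_tilt_sub_tilt_le_of_osc_sub (stapleField β e η) hVm hVb hV₂m hV₂b hosc φ L hφm hφb hL hφL
  refine key.trans (le_of_eq ?_)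
  ring

/-- **C-LIP in the coupling ON THE BALL.**  A member `(W, supp)` (bounded adapted, locally listed) whose specification at 't Hooft
coupling `β` is a Dobrushin contraction in the Vasserstein form (any door: `IsKRContraction … suFrobDist nbr C`, row sums `≤ c₁ < 1`); then
for EVERY real `β'`, every DLR state `μ` of the member at `β` and `ν` of the SAME member at `β'`, and every bounded local `f` with
Frobenius-Lipschitz vector `δ` on `Δ`: `|∫ f dμ − ∫ f dν| ≤ 2(d−1) N^{5/2} |β − β'| / (1 − c₁) · Σ_{y∈Δ} δ_y`.
[cite: Follmer1988, Ch. I Comparison Theorem (2.8)] -/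
theorem abs_integral_sub_integral_member_coupling_le (hd : 1 ≤ d) {β β' : ℝ}
    {W : Potential (ZdEdge d) (Matrix.specialUnitaryGroup (Fin N) ℂ)} (hW : W.IsAdapted)
    (hWb : ∀ X, ∃ C, ∀ U, |W X U| ≤ C) {supp : Finset (ZdEdge d) → Finset (Finset (ZdEdge d))}
    (hsupp : W.IsSupportedBy supp) {nbr : ZdEdge d → Finset (ZdEdge d)} {C : ZdEdge d → ZdEdge d → ℝ}
    (hKR : IsKRContraction (perturbedYM (d := d) (fundamentalRep (Fin N)) (N * β) W supp) suFrobDist nbr C)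
    {c₁ : ℝ} (hc0 : 0 ≤ c₁) (hc1 : c₁ < 1) (hrow : ∀ x, ∑ y ∈ nbr x, C x y ≤ c₁)
    {μ ν : Measure (LGConfig d (Matrix.specialUnitaryGroup (Fin N) ℂ))}
    (hμ : μ ∈ perturbedGibbsMeasures (d := d) (fundamentalRep (Fin N)) (N * β) W supp)
    (hν : ν ∈ perturbedGibbsMeasures (d := d) (fundamentalRep (Fin N)) (N * β') W supp)
    {f : LGConfig d (Matrix.specialUnitaryGroup (Fin N) ℂ) → ℝ} (hfm : Measurable f)
    {Δ : Finset (ZdEdge d)} (hfdep : DependsOn f (↑Δ : Set (ZdEdge d))) {M : ℝ} (hM : ∀ σ, |f σ| ≤ M)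
    {δ : ZdEdge d → ℝ} (hδ : IsLipBound suFrobDist f δ) :
    |(∫ σ, f σ ∂μ) - ∫ σ, f σ ∂ν| ≤
      2 * ((d : ℝ) - 1) * (N : ℝ) ^ 2 * Real.sqrt N * |β - β'| / (1 - c₁) * ∑ y ∈ Δ, δ y := by
  classical
  haveI : SecondCountableTopology (Matrix (Fin N) (Fin N) ℂ) :=
    inferInstanceAs (SecondCountableTopology (Fin N → Fin N → ℂ))
  haveI : SecondCountableTopology (Matrix.specialUnitaryGroup (Fin N) ℂ) :=
    Topology.IsEmbedding.subtypeVal.secondCountableTopology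
  have hWm : ∀ X, Measurable (W X) := fun X => (hW X).2
  have hd1 : (0 : ℝ) ≤ (d : ℝ) - 1 := by
    have : (1 : ℝ) ≤ d := by exact_mod_cast hd
    linarith
  have hγ : IsSpecification (perturbedYM (d := d) (fundamentalRep (Fin N)) (N * β) W supp) :=
    isSpecification_perturbedYM _ (continuous_fundamentalRep (Fin N)) _ hW hWb hsupp
  have hγ' : IsSpecification (perturbedYM (d := d) (fundamentalRep (Fin N)) (N * β') W supp) :=
    isSpecification_perturbedYM _ (continuous_fundamentalRep (Fin N)) _ hW hWb hsupp
  have hμ' : IsGibbsMeasure (perturbedYM (d := d) (fundamentalRep (Fin N)) (N * β) W supp) μ := hμ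
  have hν' : IsGibbsMeasure (perturbedYM (d := d) (fundamentalRep (Fin N)) (N * β') W supp) ν := hν
  have hR₀ : (0 : ℝ) ≤ 2 * Real.sqrt N := by positivity
  set b : ℝ := 2 * ((d : ℝ) - 1) * (N : ℝ) ^ 2 * Real.sqrt N * |β - β'| with hb
  have hb0 : 0 ≤ b := by positivity
  have hker : ∀ (x : ZdEdge d) (η : LGConfig d (Matrix.specialUnitaryGroup (Fin N) ℂ))
      (φ : Matrix.specialUnitaryGroup (Fin N) ℂ → ℝ) (L : ℝ), Measurable φ → (∃ M, ∀ s, |φ s| ≤ M) →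
      0 ≤ L → (∀ a a', |φ a - φ a'| ≤ L * suFrobDist a a') →
      |∫ s, φ s ∂(siteLaw (perturbedYM (fundamentalRep (Fin N)) (N * β) W supp) x η) -
          ∫ s, φ s ∂(siteLaw (perturbedYM (fundamentalRep (Fin N)) (N * β') W supp) x η)| ≤ b * L :=
    fun x η φ L hφm hφb hL hφL => by
      simpa only [hb] using oneLink_member_coupling_defect hd β β' hWm hWb supp x η φ L hφm hφb hL hφL
  have key := abs_integral_sub_integral_le_of_gibbs_pair hγ hγ' hKR suFrobDist_nonneg suFrobDist_le hR₀
    hc0 hc1 hrow hμ' hν' hb0 hker hfm hfdep hM hδ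
  simpa only [hb] using key

/-- **Wilson against an ARBITRARY second coupling.**  `SU(N)` on `ℤ^d` (`d ≥ 2`, `N ≥ 2`), `β` inside the one-link window of a modulus
(`OneLinkKRModulus N R K`, `2(d−1)|β| ≤ R`, `c = 6(d−1)|β|K < 1`) and ANY real `β'` (no radius condition): for DLR states `μ` at `β`, `ν` at
`β'`: `|∫ f dμ − ∫ f dν| ≤ 2(d−1) N^{5/2} |β − β'| / (1 − c) · Σ δ(f)`. [cite: Follmer1988, Ch. I Comparison Theorem (2.8)] -/
theorem abs_integral_sub_integral_le_any_coupling (hd : 2 ≤ d) (hN : 2 ≤ N) {β β' R K : ℝ} (hK : 0 ≤ K)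
    (hR : |β| * (2 * ((d : ℝ) - 1)) ≤ R) (hmod : OneLinkKRModulus N R K) (hsmall : 6 * ((d : ℝ) - 1) * |β| * K < 1)
    {μ ν : Measure (LGConfig d (Matrix.specialUnitaryGroup (Fin N) ℂ))}
    (hμ : μ ∈ ymGibbsMeasures (d := d) (fundamentalRep (Fin N)) (N * β))
    (hν : ν ∈ ymGibbsMeasures (d := d) (fundamentalRep (Fin N)) (N * β'))
    {f : LGConfig d (Matrix.specialUnitaryGroup (Fin N) ℂ) → ℝ} (hfm : Measurable f)
    {Δ : Finset (ZdEdge d)} (hfdep : DependsOn f (↑Δ : Set (ZdEdge d))) {M : ℝ} (hM : ∀ σ, |f σ| ≤ M)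
    {δ : ZdEdge d → ℝ} (hδ : IsLipBound suFrobDist f δ) :
    |(∫ σ, f σ ∂μ) - ∫ σ, f σ ∂ν| ≤
      2 * ((d : ℝ) - 1) * (N : ℝ) ^ 2 * Real.sqrt N * |β - β'| / (1 - 6 * ((d : ℝ) - 1) * |β| * K) * ∑ y ∈ Δ, δ y := by
  classical
  have hd1 : 1 ≤ d := by omega
  have hN1 : 1 ≤ N := by omega
  -- the Wilson specification as the zero member, with the empty support family
  have hW : (0 : Potential (ZdEdge d) (Matrix.specialUnitaryGroup (Fin N) ℂ)).IsAdapted :=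
    fun X => ⟨fun _ _ _ => rfl, measurable_const⟩
  have hWb : ∀ X, ∃ C, ∀ U, |(0 : Potential (ZdEdge d) (Matrix.specialUnitaryGroup (Fin N) ℂ)) X U| ≤ C :=
    fun X => ⟨0, fun U => by simp⟩
  have hsupp : (0 : Potential (ZdEdge d) (Matrix.specialUnitaryGroup (Fin N) ℂ)).IsSupportedBy (fun _ => ∅) :=
    fun _ _ _ h => (h rfl).elim
  -- Dobrushin contraction of the Wilson specification (the tree's door), transported to the zero member
  have hd2 : (2 : ℝ) ≤ d := by exact_mod_cast hd
  have hd0 : (0 : ℝ) < (d : ℝ) - 1 := by linarith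
  set c : ℝ := 6 * ((d : ℝ) - 1) * |β| * K with hc
  have hc0 : 0 ≤ c := by positivity
  set C : ZdEdge d → ZdEdge d → ℝ := fun x y => K * |β| * linkInfluence x y with hCdef
  have hC0 : ∀ x y, 0 ≤ C x y := fun x y => by positivity
  have hrow : ∀ x, ∑ y ∈ linkPlaqNbr x, C x y ≤ c := by
    intro x
    simp only [hCdef]
    rw [← Finset.mul_sum]
    have hsum : ∑ y ∈ linkPlaqNbr x, (linkInfluence x y : ℝ) ≤ 6 * ((d : ℝ) - 1) := by
      have h := sum_linkInfluence_le (d := d) x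
      calc ∑ y ∈ linkPlaqNbr x, (linkInfluence x y : ℝ)
          = ((∑ y ∈ linkPlaqNbr x, linkInfluence x y : ℕ) : ℝ) := by push_cast; rfl
        _ ≤ ((6 * (d - 1) : ℕ) : ℝ) := by exact_mod_cast h
        _ = 6 * ((d : ℝ) - 1) := by push_cast [Nat.cast_sub hd1]; ring
    calc K * |β| * ∑ y ∈ linkPlaqNbr x, (linkInfluence x y : ℝ) ≤ K * |β| * (6 * ((d : ℝ) - 1)) :=
          mul_le_mul_of_nonneg_left hsum (by positivity)
      _ = c := by rw [hc]; ring
  have hcontr : ∀ (x : ZdEdge d), ∀ y ∈ linkPlaqNbr x,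
      ∀ (ω η : LGConfig d (Matrix.specialUnitaryGroup (Fin N) ℂ)),
      (∀ z, z ≠ y → ω z = η z) →
      ∀ (φ : Matrix.specialUnitaryGroup (Fin N) ℂ → ℝ) (L : ℝ), Measurable φ →
        (∃ M, ∀ s, |φ s| ≤ M) → 0 ≤ L → (∀ a b, |φ a - φ b| ≤ L * suFrobDist a b) →
        |∫ s, φ s ∂(siteLaw (ymSpecification (fundamentalRep (Fin N)) (N * β)) x ω) -
            ∫ s, φ s ∂(siteLaw (ymSpecification (fundamentalRep (Fin N)) (N * β)) x η)| ≤
          C x y * L * suFrobDist (ω y) (η y) := by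
    intro x y _ ω η hωη φ L hφm hφb hL hφL
    rw [siteLaw_ymSpecification_thooft β x ω, siteLaw_ymSpecification_thooft β x η]
    have hBω : matrixOpNorm (stapleField β x ω) ≤ R := (matrixOpNorm_stapleField_le hd1 hN1 β x ω).trans hR
    have hBη : matrixOpNorm (stapleField β x η) ≤ R := (matrixOpNorm_stapleField_le hd1 hN1 β x η).trans hR
    have key := hmod _ _ hBω hBη φ L hφm hφb hL hφL
    refine key.trans ?_
    have hdiff := frobNorm_stapleField_sub_le β x y hωη
    calc K * L * frobNorm (stapleField β x ω - stapleField β x η)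
        ≤ K * L * (|β| * linkInfluence x y * suFrobDist (ω y) (η y)) :=
          mul_le_mul_of_nonneg_left hdiff (mul_nonneg hK hL)
      _ = C x y * L * suFrobDist (ω y) (η y) := by simp only [hCdef]; ring
  have hKR : IsKRContraction (ymSpecification (d := d) (fundamentalRep (Fin N)) (N * β)) suFrobDist linkPlaqNbr C :=
    isKRContraction_ymSpecification _ (continuous_fundamentalRep (Fin N)) _ hC0 hcontr
  have hKR' : IsKRContraction (perturbedYM (d := d) (fundamentalRep (Fin N)) (N * β) 0 fun _ => ∅) suFrobDist linkPlaqNbr C := by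
    rw [perturbedYM_zero]; exact hKR
  have hμ' : μ ∈ perturbedGibbsMeasures (d := d) (fundamentalRep (Fin N)) (N * β) 0 (fun _ => ∅) := by
    rw [perturbedGibbsMeasures_zero]; exact hμ
  have hν' : ν ∈ perturbedGibbsMeasures (d := d) (fundamentalRep (Fin N)) (N * β') 0 (fun _ => ∅) := by
    rw [perturbedGibbsMeasures_zero]; exact hν
  have key := abs_integral_sub_integral_member_coupling_le hd1 hW hWb hsupp hKR' hc0 hsmall hrow hμ' hν' hfm hfdep hM hδ
  simpa only [hc] using key

/-- **`SU(2)`, `d = 4`: C-LIP in the coupling on the ball, HYPOTHESIS-FREE** (rb-p1's lineage-(B) door for the member's contraction):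
for `0 ≤ β_W ≤ 1/6`, a member `(W, supp)` of `MemBallZd (2ε) ε R'` with `ρ = 3√3 β_W e^{2ε} + e^{ε} √(2/3) ε < 1`, ANY real `β'_W`, every DLR
state `μ` of the member at bare `β_W/2` and `ν` of the same member at bare `β'_W/2`:
`|∫ f dμ − ∫ f dν| ≤ 6√2 |β_W − β'_W| / (1 − ρ) · Σ δ(f)` (`2·3·4·√2 · |β_W − β'_W|/4`). [cite: Follmer1988, Ch. I Comparison Theorem (2.8)] -/
theorem su2_abs_integral_sub_integral_member_coupling_le {βW βW' ε R' : ℝ} (h0 : 0 ≤ βW) (h6 : βW ≤ 1 / 6)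
    {W : Potential (ZdEdge 4) (Matrix.specialUnitaryGroup (Fin 2) ℂ)}
    {supp : Finset (ZdEdge 4) → Finset (Finset (ZdEdge 4))} (hmem : MemBallZd (2 * ε) ε R' W supp)
    (hρ : 3 * Real.sqrt 3 * βW * exp (2 * ε) + exp ε * Real.sqrt (2 / 3) * ε < 1)
    {μ ν : Measure (LGConfig 4 (Matrix.specialUnitaryGroup (Fin 2) ℂ))}
    (hμ : μ ∈ perturbedGibbsMeasures (d := 4) (fundamentalRep (Fin 2)) (2 * (βW / 4)) W supp)
    (hν : ν ∈ perturbedGibbsMeasures (d := 4) (fundamentalRep (Fin 2)) (2 * (βW' / 4)) W supp)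
    {f : LGConfig 4 (Matrix.specialUnitaryGroup (Fin 2) ℂ) → ℝ} (hfm : Measurable f)
    {Δ : Finset (ZdEdge 4)} (hfdep : DependsOn f (↑Δ : Set (ZdEdge 4))) {M : ℝ} (hM : ∀ σ, |f σ| ≤ M)
    {δ : ZdEdge 4 → ℝ} (hδ : IsLipBound suFrobDist f δ) :
    |(∫ σ, f σ ∂μ) - ∫ σ, f σ ∂ν| ≤
      6 * Real.sqrt 2 * |βW - βW'| / (1 - (3 * Real.sqrt 3 * βW * exp (2 * ε) + exp ε * Real.sqrt (2 / 3) * ε)) *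
        ∑ y ∈ Δ, δ y := by
  haveI : SecondCountableTopology (Matrix (Fin 2) (Fin 2) ℂ) :=
    inferInstanceAs (SecondCountableTopology (Fin 2 → Fin 2 → ℂ))
  haveI : SecondCountableTopology (Matrix.specialUnitaryGroup (Fin 2) ℂ) :=
    Topology.IsEmbedding.subtypeVal.secondCountableTopology
  obtain ⟨osc₁, lip₁, hosc₁, hlip₁, hosca₁, hΛ₁⟩ := hmem.loads
  have hW : W.IsAdapted := fun X => ⟨hmem.dependsOn X, (hmem.continuous X).measurable⟩
  have hWb : ∀ X, ∃ C, ∀ U, |W X U| ≤ C := fun X => exists_bound_of_continuous (hmem.continuous X)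
  have hc : (0 : ℝ) ≤ 2 / 3 := by norm_num
  have hb : |βW / 4| * (2 * (((4 : ℕ) : ℝ) - 1)) ≤ 1 / 4 := by
    rw [abs_of_nonneg (by positivity)]; push_cast; linarith
  have hP : ∀ B : Matrix (Fin 2) (Fin 2) ℂ, matrixOpNorm B ≤ 1 / 4 →
      ∀ (ψ : Matrix.specialUnitaryGroup (Fin 2) ℂ → ℝ) (M : ℝ), 0 ≤ M →
        (∀ x y, |ψ x - ψ y| ≤ M * suFrobDist x y) →
        Var[ψ; (haarProbability (Matrix.specialUnitaryGroup (Fin 2) ℂ)).tilted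
          fun g => ((2 : ℕ) : ℝ) * ((g : Matrix (Fin 2) (Fin 2) ℂ) * B).trace.re] ≤ 2 / 3 * M ^ 2 :=
    fun B hB ψ M hM hψ => oneLinkPoincareSUN_two_sharp _ B hB ψ M hM hψ
  have hKR := isKRContraction_perturbedYM_SU (d := 4) (N := 2) (by norm_num) (by norm_num) (a := 2 * ε) hc
    zero_le_two hb hP (su2_linVariance_sharp le_rfl) hW hosc₁ hosca₁ hlip₁
  set ρ : ℝ := 3 * Real.sqrt 3 * βW * exp (2 * ε) + exp ε * Real.sqrt (2 / 3) * ε with hρdef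
  have hsq : Real.sqrt (2 / 3 * 2) = 2 * Real.sqrt 3 / 3 := by
    have h3 : (2 * Real.sqrt 3 / 3) ^ 2 = 2 / 3 * 2 := by
      rw [div_pow, mul_pow, Real.sq_sqrt (by norm_num)]; norm_num
    rw [← h3, Real.sqrt_sq (by positivity)]
  have hrow : ∀ e, ∑ y ∈ perturbedNbr supp e,
      (exp (2 * ε) * Real.sqrt (2 / 3 * 2) * |βW / 4| * linkInfluence e y +
        exp (2 * ε / 2) * Real.sqrt (2 / 3) * ∑ X ∈ (supp {e}).filter (fun X => e ∈ X), lip₁ X y) ≤ ρ := by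
    intro e
    refine (sum_perturbedNbr_coeff_le (d := 4) (by norm_num) hΛ₁ e).trans (le_of_eq ?_)
    rw [hsq, show 2 * ε / 2 = ε by ring, abs_of_nonneg (by positivity : (0 : ℝ) ≤ βW / 4), hρdef]
    push_cast
    ring
  have hρ0 : 0 ≤ ρ := by
    have hε : 0 ≤ ε := by
      have e₀ : ZdEdge 4 := (0, ⟨0, by norm_num⟩)
      have h := hΛ₁ e₀
      exact (Finset.sum_nonneg fun y _ => Finset.sum_nonneg fun X _ => (hlip₁ X).nonneg y).trans h
    positivity
  have key := abs_integral_sub_integral_member_coupling_le (d := 4) (N := 2) (by norm_num) hW hWb hmem.supportedBy hKR hρ0 hρ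
    hrow hμ hν hfm hfdep hM hδ
  have he : 2 * (((4 : ℕ) : ℝ) - 1) * (((2 : ℕ) : ℝ)) ^ 2 * Real.sqrt ((2 : ℕ) : ℝ) * |βW / 4 - βW' / 4| / (1 - ρ) =
      6 * Real.sqrt 2 * |βW - βW'| / (1 - ρ) := by
    rw [show βW / 4 - βW' / 4 = (βW - βW') / 4 by ring, abs_div, abs_of_pos (by norm_num : (0 : ℝ) < 4)]
    push_cast
    ring
  rw [he] at key
  exact key

end Summit.Ventures.YMGap.RobustBall.StateLipschitzMember

end
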